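/-
TEAM hComp (cell pub-hodgecm2) — seat hcomp-shimura gen 9 / v3 gen 10.  STAGED, NOT FILED (CARRIERS-PLAN step S6, Summits-side bridge):
files only on the hcomp-lead's word, after (U7) `ShimuraVarieties/UnitaryShimuraCanonicalModelHecke.lean`, S1 `AppendixC/RestOne.lean`
and S6 PART 1 `AppendixC/HeckeTranslates.lean` are in the tree (v4: imports PART 1 only — no dependence on S1 `RestOne.lean` or on
S6 PART 2 `RestOneHecke.lean`).  v3/v4 = v2.1 with the two cited facts `hU7`, `h` (and the carriers `F, ι₁, V, Φ`)
as EXPLICIT binders on every declaration instead of a `variable` line (lead gen 7 HYGIENE l.4666 (2): pre-filing conversion of a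
not-yet-filed file; positional API unchanged; the filing note discloses the conversion and invites the D-0026 question — nothing of
`heckeTranslate_definedOver` / `exists_recordSystem` is concluded here, both are hypotheses of every declaration).  HC_CM is NOT proved.
-/
import Summits.HodgeConjecture.CorCM.B01.Transposition.HComp.HonestP5OfNonVacuity
import Literature.AlgebraicGeometry.ShimuraVarieties.UnitaryShimuraCanonicalModelHecke
import Literature.NumberTheory.Automorphic.Liu2021.AppendixC.HeckeTranslates
import HarnessLib

/-!
# COR-CM / B01 — S2 pinning, TEAM hComp: the Hecke translates of the chosen record system, carried to Liu's §4.2 datum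

[Liu2021] §4.2 l. 2074: «Then the Hecke correspondences provide a homomorphism `𝔾(𝔸_F^∞) → Aut_E(A_∞)`»; Def. 4.16 l. 2219:
«`𝔾(𝔸_F^∞)` acts `M_μ`-linearly via its action on `A_∞`».  For the S2 instance (`P5 := Model.honestP5Of h F ι₁ V Φ`, the honest
Prop-C.5 datum of the CHOSEN canonical-model system `Model.recordOf h V h4` of Deligne's models `M_K`, `K ≤ K_f(3)`) the Hecke
translates `T_g : M_K ⟶ M_{K'}` (`g⁻¹Kg ⊆ K'`) are [Milne2005ShimuraVarieties] Thm. 13.6 = the named fact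
`UnitaryCanonicalModel.heckeTranslate_definedOver` ((U7), `ShimuraVarieties/UnitaryShimuraCanonicalModelHecke.lean`); this file
carries them to the system of Shimura varieties `Sh(𝕍)_K = X_K = M_K ⊗_{F,c} F` of `Model.honestSystemOf h V Φ` and to the §4.2
datum built over it in the Compact Case, so that `AppendixC/RestOneHecke.lean` (S6) CONSTRUCTS `Thm418Rest.rhoΩ` there.

* `Model.recordHeckeTranslate hU7 h V h4 g K K' hK : M_K ⟶ M_{K'}` — the (unique) translate of the chosen record, from `hU7`
  (choice); `…_one` (= the record's transition morphism, `heckeTranslate_eq_map_of_le`), `…_mul` (`T_g ≫ T_{g'} = T_{gg'}`,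
  `isHeckeTranslate_comp` + `heckeTranslate_unique`), `…_self` (`T_k = 𝟙` for `k ∈ K`, `heckeTranslate_eq_id_of_mem`) — THEOREMS
  over the record;
* `Model.recordFunctorHeckeTranslate` — the same on the total record functor `recordFunctorOf h V` (along `recordFunctorOf_objIso`);
* `Model.heckeTranslatesOf hU7 h V Φ h4 : IncoherentShimuraSystem.HeckeTranslates (honestSystemOf h V Φ)` — base change along the
  complex conjugation `c` of `F` (`conjSystem = M ⋙ baseChangeHom c`);
* `Model.sec42HeckeTranslatesOf hU7 h V Φ h4 iso alb : Sec42Data.HeckeTranslates (Sec42Data.ofAlbanese _ (honestSystemOf h V Φ) _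
  (compactifiedOf h V Φ h4) alb)` — (m10) of CARRIERS-PLAN §2.R5 INHABITED at the S2 instance for every choice `alb` of Albanese data
  (S5's `sec42DataOf` is of this form), CONDITIONAL on the two cited facts `h` ([Deligne1979] 2.2.5 / Cor. 2.7.21) and `hU7`
  ([Milne2005ShimuraVarieties] Thm. 13.6).

Consequence (not restated here): `(Model.sec42HeckeTranslatesOf …).restOne φ ι hμ hw Car Eps epsOf Chi omega rho : Thm418Rest _`
(`RestOneHecke.lean`) has `Obj ∕ Aμ ∕ Ω ∕ rhoΩ ∕ res ∕ res_pull` constructed.  No `sorry`, no new axioms, no named fact introduced, no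
instance; T5: n/a for filing purposes until the lead says otherwise (binders `hU7`, `h` are two cited named facts, no Hodge-side
hypothesis; a T5 line will be requested before any filing).  HC_CM is NOT proved; S2 is NOT closed; nothing here is consumed by
any closing term.

References: [Liu2021] §4.2 l. 2060–2074, Def. 4.16 l. 2218–2224, Prop. C.5 l. 4627–4633, App. C l. 4656;
[Milne2005ShimuraVarieties] Def. 12.10 (a) p. 115 L7–10, §13 p. 118 L21–28 (Thm. 13.6), §5 p. 57 L7–12, p. 58 L3–11 and Def. 5.14;
[Deligne1979ShimuraVarieties] 2.1.4, 2.2.5, Cor. 2.7.21.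
-/

set_option autoImplicit false

noncomputable section

namespace Summit.HodgeConjecture.CorCM.Model

open CategoryTheory AlgebraicGeometry NumberField
open Literature.AlgebraicGeometry.Motives
open Literature.AlgebraicGeometry.ShimuraVarieties.UnitaryCanonicalModel
open Literature.NumberTheory.Automorphic
open Literature.NumberTheory.Automorphic.Liu2021
open Literature.NumberTheory.Automorphic.Liu2021.AppendixC
open Summit.HodgeConjecture.CorCM.HComp

/-! ## §1  The Hecke translates of the chosen record system (from (U7)) -/

/-- **`T_g : M_K ⟶ M_{K'}` for the CHOSEN record system** `Model.recordOf h V h4` (`g ∈ U(V)(𝔸_{F⁺,f})`, `K, K' ≤ K_f(3)`, `g⁻¹Kg ⊆ K'`):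
the `F`-morphism of Deligne's models acting as `[z, aK] ↦ [z, agK']` on complex points, CHOSEN from the named fact
`heckeTranslate_definedOver` ([Milne2005ShimuraVarieties] Thm. 13.6) at the hypotheses the tree reads off `V` (`V.posDef_of_ne`,
`HermSpace3.anisotropic_of_four_le`, `HComp.torsionFree_arithmeticLevel_conj_K3`).  CONDITIONAL on `hU7`, `h`.
[cite: Milne2005ShimuraVarieties, Thm. 13.6 p. 118 L21–28] [cite: Deligne1979ShimuraVarieties, 2.2.5 and Cor. 2.7.21] -/
def recordHeckeTranslate
    (hU7 : heckeTranslate_definedOver) (h : exists_recordSystem) {F : CMField} {ι₁ : F →+* ℂ} (V : HermSpace3 F ι₁) (h4 : 4 ≤ Module.finrank ℚ F) (g : ↥V.adelicFin) (K K' : C5.SmallLevel (K3 V))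
    (hK : C5.HeckeLE g K K') : (recordOf h V h4).M.obj K ⟶ (recordOf h V h4).M.obj K' :=
  ((recordOf h V h4).exists_heckeTranslate hU7 V.posDef_of_ne (V.anisotropic_of_four_le h4)
    (torsionFree_arithmeticLevel_conj_K3 V) g K K' hK).choose

/-- The chosen morphism IS a Hecke translate: `pts_{K'} (T_g ∘ pts_K⁻¹ [z, aK]) = [z, agK']`.
[cite: Milne2005ShimuraVarieties, §13 p. 118 L21–26 and Thm. 13.6] -/
theorem isHeckeTranslate_recordHeckeTranslate
    (hU7 : heckeTranslate_definedOver) (h : exists_recordSystem) {F : CMField} {ι₁ : F →+* ℂ} (V : HermSpace3 F ι₁) (h4 : 4 ≤ Module.finrank ℚ F) (g : ↥V.adelicFin)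
    (K K' : C5.SmallLevel (K3 V)) (hK : C5.HeckeLE g K K') :
    (recordOf h V h4).IsHeckeTranslate K K' g (recordHeckeTranslate hU7 h V h4 g K K' hK) :=
  ((recordOf h V h4).exists_heckeTranslate hU7 V.posDef_of_ne (V.anisotropic_of_four_le h4)
    (torsionFree_arithmeticLevel_conj_K3 V) g K K' hK).choose_spec

/-- **`T_1` is the record's own transition morphism** `M_K ⟶ M_{K'}` (`K ≤ K'`; [Deligne1979ShimuraVarieties] 2.1.4 = the record field
`map_pts`, uniqueness `heckeTranslate_eq_map_of_le`). [cite: Deligne1979ShimuraVarieties, 2.1.4] [cite: Milne2005ShimuraVarieties, Thm. 13.7 (a) p. 119] -/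
theorem recordHeckeTranslate_one
    (hU7 : heckeTranslate_definedOver) (h : exists_recordSystem) {F : CMField} {ι₁ : F →+* ℂ} (V : HermSpace3 F ι₁) (h4 : 4 ≤ Module.finrank ℚ F) {K K' : C5.SmallLevel (K3 V)} (f : K ⟶ K') :
    recordHeckeTranslate hU7 h V h4 1 K K' (C5.HeckeLE.one_of_le f.le) = (recordOf h V h4).M.map f :=
  (recordOf h V h4).heckeTranslate_eq_map_of_le f (isHeckeTranslate_recordHeckeTranslate hU7 h V h4 1 K K' _)

/-- **`T_g ≫ T_{g'} = T_{gg'}`** for the chosen translates (both act as `[z,aK] ↦ [z, agg'K'']`; uniqueness).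
[cite: Milne2005ShimuraVarieties, §5 p. 58 L6–11 and Thm. 13.6 p. 118] -/
theorem recordHeckeTranslate_mul
    (hU7 : heckeTranslate_definedOver) (h : exists_recordSystem) {F : CMField} {ι₁ : F →+* ℂ} (V : HermSpace3 F ι₁) (h4 : 4 ≤ Module.finrank ℚ F) (g g' : ↥V.adelicFin) {K K' K'' : C5.SmallLevel (K3 V)}
    (hK : C5.HeckeLE g K K') (hK' : C5.HeckeLE g' K' K'') :
    recordHeckeTranslate hU7 h V h4 g K K' hK ≫ recordHeckeTranslate hU7 h V h4 g' K' K'' hK' =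
      recordHeckeTranslate hU7 h V h4 (g * g') K K'' (hK.mul hK') :=
  (recordOf h V h4).heckeTranslate_unique
    ((recordOf h V h4).isHeckeTranslate_comp (isHeckeTranslate_recordHeckeTranslate hU7 h V h4 g K K' hK)
      (isHeckeTranslate_recordHeckeTranslate hU7 h V h4 g' K' K'' hK'))
    (isHeckeTranslate_recordHeckeTranslate hU7 h V h4 (g * g') K K'' _)

/-- **`T_k = 𝟙` for `k ∈ K`** for the chosen translates (`[z, akK] = [z, aK]`; uniqueness, `heckeTranslate_eq_id_of_mem`).
[cite: Milne2005ShimuraVarieties, §5 p. 57 L7–12 and Thm. 13.6 p. 118] -/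
theorem recordHeckeTranslate_self
    (hU7 : heckeTranslate_definedOver) (h : exists_recordSystem) {F : CMField} {ι₁ : F →+* ℂ} (V : HermSpace3 F ι₁) (h4 : 4 ≤ Module.finrank ℚ F) {K : C5.SmallLevel (K3 V)} {k : ↥V.adelicFin}
    (hk : k ∈ K.1.1) : recordHeckeTranslate hU7 h V h4 k K K (C5.HeckeLE.of_mem hk) = 𝟙 ((recordOf h V h4).M.obj K) :=
  (recordOf h V h4).heckeTranslate_eq_id_of_mem hk (isHeckeTranslate_recordHeckeTranslate hU7 h V h4 k K K _)

/-! ## §2  On the total record functor `recordFunctorOf h V` (along `recordFunctorOf_objIso`) -/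

/-- The translate on the TOTAL record functor `K ↦ (recordFunctorOf h V) K` (= `M_K` for `4 ≤ [F:ℚ]`, `recordFunctorOf_objIso`):
`iso_K ≫ T_g ≫ iso_{K'}⁻¹`. [cite: Milne2005ShimuraVarieties, Thm. 13.6 p. 118] [cite: Deligne1979ShimuraVarieties, 2.2.5] -/
def recordFunctorHeckeTranslate
    (hU7 : heckeTranslate_definedOver) (h : exists_recordSystem) {F : CMField} {ι₁ : F →+* ℂ} (V : HermSpace3 F ι₁) (h4 : 4 ≤ Module.finrank ℚ F) (g : ↥V.adelicFin) (K K' : C5.SmallLevel (K3 V))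
    (hK : C5.HeckeLE g K K') : (recordFunctorOf h V).obj K ⟶ (recordFunctorOf h V).obj K' :=
  (recordFunctorOf_objIso h V h4 K).hom ≫ recordHeckeTranslate hU7 h V h4 g K K' hK ≫ (recordFunctorOf_objIso h V h4 K').inv

/-- `T_1` on the total record functor is its transition morphism (naturality of `recordFunctorOfIso`).
[cite: Deligne1979ShimuraVarieties, 2.1.4 and 2.2.5] -/
theorem recordFunctorHeckeTranslate_one
    (hU7 : heckeTranslate_definedOver) (h : exists_recordSystem) {F : CMField} {ι₁ : F →+* ℂ} (V : HermSpace3 F ι₁) (h4 : 4 ≤ Module.finrank ℚ F) {K K' : C5.SmallLevel (K3 V)} (f : K ⟶ K') :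
    recordFunctorHeckeTranslate hU7 h V h4 1 K K' (C5.HeckeLE.one_of_le f.le) = (recordFunctorOf h V).map f := by
  rw [recordFunctorHeckeTranslate, recordHeckeTranslate_one]
  have nat := (recordFunctorOfIso h V h4).hom.naturality f
  change (recordFunctorOfIso h V h4).hom.app K ≫ (recordOf h V h4).M.map f ≫ (recordFunctorOfIso h V h4).inv.app K' = _
  rw [← Category.assoc, ← nat, Category.assoc, Iso.hom_inv_id_app, Category.comp_id]

/-- `T_g ≫ T_{g'} = T_{gg'}` on the total record functor. [cite: Milne2005ShimuraVarieties, §5 p. 58 L6–11 and Thm. 13.6 p. 118] -/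
theorem recordFunctorHeckeTranslate_mul
    (hU7 : heckeTranslate_definedOver) (h : exists_recordSystem) {F : CMField} {ι₁ : F →+* ℂ} (V : HermSpace3 F ι₁) (h4 : 4 ≤ Module.finrank ℚ F) (g g' : ↥V.adelicFin) {K K' K'' : C5.SmallLevel (K3 V)}
    (hK : C5.HeckeLE g K K') (hK' : C5.HeckeLE g' K' K'') :
    recordFunctorHeckeTranslate hU7 h V h4 g K K' hK ≫ recordFunctorHeckeTranslate hU7 h V h4 g' K' K'' hK' =
      recordFunctorHeckeTranslate hU7 h V h4 (g * g') K K'' (hK.mul hK') := by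
  simp only [recordFunctorHeckeTranslate, Category.assoc, Iso.inv_hom_id_assoc]
  rw [← recordHeckeTranslate_mul hU7 h V h4 g g' hK hK', Category.assoc]

/-- `T_k = 𝟙` on the total record functor for `k ∈ K`. [cite: Milne2005ShimuraVarieties, §5 p. 57 L7–12] -/
theorem recordFunctorHeckeTranslate_self
    (hU7 : heckeTranslate_definedOver) (h : exists_recordSystem) {F : CMField} {ι₁ : F →+* ℂ} (V : HermSpace3 F ι₁) (h4 : 4 ≤ Module.finrank ℚ F) {K : C5.SmallLevel (K3 V)} {k : ↥V.adelicFin}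
    (hk : k ∈ K.1.1) :
    recordFunctorHeckeTranslate hU7 h V h4 k K K (C5.HeckeLE.of_mem hk) = 𝟙 ((recordFunctorOf h V).obj K) := by
  rw [recordFunctorHeckeTranslate, recordHeckeTranslate_self hU7 h V h4 hk, Category.id_comp, Iso.hom_inv_id]

/-! ## §3  On the honest system of Shimura varieties `Sh(𝕍)_K = M_K ⊗_{F,c} F` and on the §4.2 datum (Compact Case) -/

/-- **Hecke translates on `Model.honestSystemOf h V Φ`** (`Sh(𝕍)_K := X_K = M_K ⊗_{F,c} F`, `conjSystem = M ⋙ baseChangeHom c`): the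
base change along the complex conjugation `c` of `F` of the record's translates; `T_1` = transition and `T_g ≫ T_{g'} = T_{gg'}` by
functoriality of base change.  For `4 ≤ [F:ℚ]` (the only case the chain reads; face guard `6 ≤ [F:ℚ]`).  CONDITIONAL on `hU7`, `h`;
HC_CM is NOT proved. [cite: Liu2021, Prop. C.5 l. 4627–4633 and §4.2 l. 2074] [cite: Milne2005ShimuraVarieties, Def. 12.10 (a) p. 115 and Thm. 13.6 p. 118] -/
def heckeTranslatesOf
    (hU7 : heckeTranslate_definedOver) (h : exists_recordSystem) {F : CMField} {ι₁ : F →+* ℂ} (V : HermSpace3 F ι₁)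
    (Φ : Literature.AlgebraicGeometry.Motives.CMType F) (h4 : 4 ≤ Module.finrank ℚ F) : IncoherentShimuraSystem.HeckeTranslates (honestSystemOf h V Φ) where
  tr g K K' hK := (baseChangeHom (cmConjRingHom F)).map (recordFunctorHeckeTranslate hU7 h V h4 g K K' hK)
  tr_one := fun {K K'} f => by
    show (baseChangeHom (cmConjRingHom F)).map _ = (baseChangeHom (cmConjRingHom F)).map ((recordFunctorOf h V).map f)
    rw [recordFunctorHeckeTranslate_one]
  tr_mul := fun g g' {K K' K''} hK hK' => by
    show (baseChangeHom (cmConjRingHom F)).map _ ≫ (baseChangeHom (cmConjRingHom F)).map _ =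
      (baseChangeHom (cmConjRingHom F)).map _
    rw [← Functor.map_comp, recordFunctorHeckeTranslate_mul]
  tr_self := fun {K k} hk => by
    show (baseChangeHom (cmConjRingHom F)).map _ = 𝟙 ((baseChangeHom (cmConjRingHom F)).obj ((recordFunctorOf h V).obj K))
    rw [recordFunctorHeckeTranslate_self hU7 h V h4 hk, CategoryTheory.Functor.map_id]

/-- The translate of the honest system is the base-changed record translate (by `rfl`). [cite: Liu2021, Prop. C.5 l. 4627–4633] -/
theorem heckeTranslatesOf_tr
    (hU7 : heckeTranslate_definedOver) (h : exists_recordSystem) {F : CMField} {ι₁ : F →+* ℂ} (V : HermSpace3 F ι₁)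
    (Φ : Literature.AlgebraicGeometry.Motives.CMType F) (h4 : 4 ≤ Module.finrank ℚ F) (g : ↥V.adelicFin)
    (K K' : C5.SmallLevel (honestSystemOf h V Φ).K₀) (hK : C5.HeckeLE g K K') :
    (heckeTranslatesOf hU7 h V Φ h4).tr g K K' hK =
      (baseChangeHom (cmConjRingHom F)).map (recordFunctorHeckeTranslate hU7 h V h4 g K K' hK) := rfl

/-- **(m10) of CARRIERS-PLAN §2.R5 INHABITED at the S2 instance**: Hecke translates on the §4.2 datum over the honest system in the
Compact Case (`X_K = Sh(𝕍)_K`, `Model.compactifiedOf`; [Liu2021] App. C l. 4656) for EVERY choice `alb` of Albanese data of the `X_K`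
(the shape of S5's `sec42DataOf`), from the two cited facts `h` ([Deligne1979ShimuraVarieties] 2.2.5 / Cor. 2.7.21) and `hU7`
([Milne2005ShimuraVarieties] Thm. 13.6).  With it `RestOneHecke.lean`'s `HeckeTranslates.restOne` gives a `Thm418Rest` whose
`Obj ∕ Aμ ∕ Ω ∕ rhoΩ ∕ res ∕ res_pull` are all constructed.  HC_CM is NOT proved; nothing here is a binder of a closing term.
[cite: Liu2021, §4.2 l. 2060–2074, Def. 4.16 l. 2219, App. C l. 4656] [cite: Milne2005ShimuraVarieties, Thm. 13.6 p. 118] -/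
def sec42HeckeTranslatesOf
    (hU7 : heckeTranslate_definedOver) (h : exists_recordSystem) {F : CMField} {ι₁ : F →+* ℂ} (V : HermSpace3 F ι₁)
    (Φ : Literature.AlgebraicGeometry.Motives.CMType F) (h4 : 4 ≤ Module.finrank ℚ F) (iso : ℕ → Prop)
    (alb : ∀ K : C5.SmallLevel (honestSystemOf h V Φ).K₀, Albanese ((honestSystemOf h V Φ).Sh𝕍.obj K)) :
    (Sec42Data.ofAlbanese (isotropicAt := iso) (Nat.le_of_ble_eq_true rfl) (honestSystemOf h V Φ)
      (isProjectiveOver_honestSystemOf_Sh_iff h V Φ h4 iso) (compactifiedOf h V Φ h4) alb).HeckeTranslates :=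
  (heckeTranslatesOf hU7 h V Φ h4).ofProjective (Nat.le_of_ble_eq_true rfl)
    (isProjectiveOver_honestSystemOf_Sh_iff h V Φ h4 iso) (smooth_honestSystemOf_Sh h V Φ h4)
    (projective_honestSystemOf_Sh h V Φ h4) alb

/-- The same under the chain's face guard `6 ≤ [F:ℚ]`. [cite: Liu2021, §4.2 l. 2060–2074] -/
def sec42HeckeTranslatesOf_of_six_le
    (hU7 : heckeTranslate_definedOver) (h : exists_recordSystem) {F : CMField} {ι₁ : F →+* ℂ} (V : HermSpace3 F ι₁)
    (Φ : Literature.AlgebraicGeometry.Motives.CMType F) (h6 : 6 ≤ Module.finrank ℚ F) (iso : ℕ → Prop)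
    (alb : ∀ K : C5.SmallLevel (honestSystemOf h V Φ).K₀, Albanese ((honestSystemOf h V Φ).Sh𝕍.obj K)) :
    (Sec42Data.ofAlbanese (isotropicAt := iso) (Nat.le_of_ble_eq_true rfl) (honestSystemOf h V Φ)
      (isProjectiveOver_honestSystemOf_Sh_iff h V Φ (le_trans (by norm_num) h6) iso)
      (compactifiedOf h V Φ (le_trans (by norm_num) h6)) alb).HeckeTranslates :=
  sec42HeckeTranslatesOf hU7 h V Φ (le_trans (by norm_num) h6) iso alb

end Summit.HodgeConjecture.CorCM.Model

end
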